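import Mathlib.Analysis.Normed.Operator.Bilinear
import Literature.Analysis.Calculus.QuadraticFixedPoint
import HarnessLib

/-!
# Albritton–Brué–Colombo 2022, §4.2.2: the abstract contraction claim behind the construction
  of `U^{per}`

Analysis/FluidPDE proofs-layer file (theorems only), a rung of the proof line of the named fact
`Literature.Analysis.FluidPDE.albritton_brue_colombo` (Albritton–Brué–Colombo, Ann. of Math. 196
(2022) = arXiv:2112.03116 [ABC], Thm. 1.2) ABOVE the assembly of
`NSLerayHopfABCAssembly.lean`: the perturbation `U^{per}` of Thm. 1.3 (b) / Prop. 4.5 is the fixed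
point of `𝒯(U) = B(U,U) + LU + G` in the weighted space `X` of (4.18)–(4.19), obtained from the
"elementary claim" of §4.2.2 ("Abstract claim", verbatim): *Let `X` be a Banach space and
`𝒯(U) := B(U,U) + LU + G`, `U ∈ X`, where `G ∈ X`, `L : X → X` is a bounded linear operator and
`B : X × X → X` is a bounded bilinear form. If `‖L‖ + 2‖B‖ + ‖G‖_X < 1`, then
`𝒯 : {‖U‖_X ≤ 1} → {‖U‖_X ≤ 1}` is a contraction.* "Indeed, if `‖U‖_X ≤ 1`, then
`‖𝒯U‖_X ≤ ‖B‖‖U‖² + ‖L‖‖U‖ + ‖G‖ < 1` … `‖𝒯(U) − 𝒯(V)‖ ≤ ‖B(U−V,U)‖ + ‖B(V,U−V)‖ + ‖L‖‖U−V‖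
≤ (2‖B‖ + ‖L‖)‖U − V‖`, since `2‖B‖ + ‖L‖ < 1`, we conclude that `𝒯` is a contraction."

Proved here in Mathlib generality (`X` a real Banach space, `B : X →L[ℝ] X →L[ℝ] X`,
`L : X →L[ℝ] X`, operator norms): `AlbrittonBrueColombo2022.abstractClaim_mapsTo`,
`abstractClaim_lipschitz`, and the consequence the paper uses ("To find the sought fixed point we
apply the contraction mapping principle"): `abstractClaim_exists_unique_fixedPoint` — a unique
fixed point in the closed unit ball (Banach's theorem on the complete subset, via the tree's
`Literature.Analysis.Calculus.exists_isFixedPt_mem_closedBall`). Nothing specific to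
Navier–Stokes; the tree's `exists_fixedPoint_of_bilinear` (`BilinearFixedPoint.lean`,
`x = y + B(x,x)`, Lemarié-Rieusset §6.6) is the case `L = 0` with a different normalisation.

## References

* D. Albritton, E. Brué, M. Colombo, Ann. of Math. 196 (2022) = arXiv:2112.03116, §4.2.2
  (abstract claim), Prop. 4.7, (4.18)–(4.24). [AlbrittonBrueColombo2022]
-/

noncomputable section

open Set Metric Function

namespace Literature.Analysis.FluidPDE

namespace AlbrittonBrueColombo2022

variable {X : Type*} [NormedAddCommGroup X] [NormedSpace ℝ X]

/-- The map `𝒯(U) = B(U,U) + LU + G` of [ABC] §4.2.2. [cite: AlbrittonBrueColombo2022, §4.2.2] -/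
theorem abstractClaim_norm_le (B : X →L[ℝ] X →L[ℝ] X) (L : X →L[ℝ] X) (G U : X) :
    ‖B U U + L U + G‖ ≤ ‖B‖ * ‖U‖ * ‖U‖ + ‖L‖ * ‖U‖ + ‖G‖ :=
  calc ‖B U U + L U + G‖ ≤ ‖B U U‖ + ‖L U‖ + ‖G‖ := norm_add₃_le
    _ ≤ ‖B‖ * ‖U‖ * ‖U‖ + ‖L‖ * ‖U‖ + ‖G‖ :=
        add_le_add (add_le_add (B.le_opNorm₂ U U) (L.le_opNorm U)) le_rfl

/-- **[ABC] §4.2.2, first half of the claim**: if `‖L‖ + 2‖B‖ + ‖G‖ < 1` then `𝒯` maps the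
closed unit ball into itself ("if `‖U‖_X ≤ 1`, then `‖𝒯U‖ ≤ ‖B‖‖U‖² + ‖L‖‖U‖ + ‖G‖ < 1`").
[cite: AlbrittonBrueColombo2022, §4.2.2 (4.21)–(4.22)] -/
theorem abstractClaim_mapsTo (B : X →L[ℝ] X →L[ℝ] X) (L : X →L[ℝ] X) (G : X)
    (h : ‖L‖ + 2 * ‖B‖ + ‖G‖ < 1) :
    MapsTo (fun U => B U U + L U + G) (closedBall (0 : X) 1) (closedBall 0 1) := by
  intro U hU
  rw [mem_closedBall_zero_iff] at hU ⊢
  have hB : 0 ≤ ‖B‖ := ContinuousLinearMap.opNorm_nonneg B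
  have hL : 0 ≤ ‖L‖ := ContinuousLinearMap.opNorm_nonneg L
  have hU0 : 0 ≤ ‖U‖ := norm_nonneg _
  calc ‖B U U + L U + G‖ ≤ ‖B‖ * ‖U‖ * ‖U‖ + ‖L‖ * ‖U‖ + ‖G‖ := abstractClaim_norm_le B L G U
    _ ≤ ‖B‖ * 1 * 1 + ‖L‖ * 1 + ‖G‖ := by gcongr
    _ ≤ 1 := by linarith

/-- **[ABC] §4.2.2, second half of the claim**: on the closed unit ball `𝒯` is Lipschitz with
constant `2‖B‖ + ‖L‖` ("`‖𝒯(U) − 𝒯(V)‖ ≤ ‖B(U−V,U)‖ + ‖B(V,U−V)‖ + ‖L‖‖U−V‖ ≤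
(2‖B‖ + ‖L‖)‖U − V‖`"). [cite: AlbrittonBrueColombo2022, §4.2.2 (4.23)–(4.24)] -/
theorem abstractClaim_lipschitz (B : X →L[ℝ] X →L[ℝ] X) (L : X →L[ℝ] X) (G : X) {U V : X}
    (hU : ‖U‖ ≤ 1) (hV : ‖V‖ ≤ 1) :
    ‖(B U U + L U + G) - (B V V + L V + G)‖ ≤ (2 * ‖B‖ + ‖L‖) * ‖U - V‖ := by
  have hB : 0 ≤ ‖B‖ := ContinuousLinearMap.opNorm_nonneg B
  have h1 : (B U U + L U + G) - (B V V + L V + G) = B (U - V) U + B V (U - V) + L (U - V) := by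
    simp only [map_sub, FunLike.coe_sub, Pi.sub_apply]
    abel
  rw [h1]
  calc ‖B (U - V) U + B V (U - V) + L (U - V)‖
      ≤ ‖B (U - V) U‖ + ‖B V (U - V)‖ + ‖L (U - V)‖ := norm_add₃_le
    _ ≤ ‖B‖ * ‖U - V‖ * ‖U‖ + ‖B‖ * ‖V‖ * ‖U - V‖ + ‖L‖ * ‖U - V‖ :=
        add_le_add (add_le_add (B.le_opNorm₂ _ _) (B.le_opNorm₂ _ _)) (L.le_opNorm _)
    _ ≤ ‖B‖ * ‖U - V‖ * 1 + ‖B‖ * 1 * ‖U - V‖ + ‖L‖ * ‖U - V‖ := by gcongr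
    _ = (2 * ‖B‖ + ‖L‖) * ‖U - V‖ := by ring

/-- **The fixed point** ("To find the sought fixed point we apply the contraction mapping
principle", [ABC] before Prop. 4.7): in a real Banach space, if `‖L‖ + 2‖B‖ + ‖G‖ < 1` then
`𝒯(U) = B(U,U) + LU + G` has exactly one fixed point in the closed unit ball. [cite: AlbrittonBrueColombo2022, §4.2.2 and Prop. 4.7] -/
theorem abstractClaim_exists_unique_fixedPoint [CompleteSpace X] (B : X →L[ℝ] X →L[ℝ] X)
    (L : X →L[ℝ] X) (G : X) (h : ‖L‖ + 2 * ‖B‖ + ‖G‖ < 1) :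
    ∃! U : X, ‖U‖ ≤ 1 ∧ B U U + L U + G = U := by
  have hB : 0 ≤ ‖B‖ := ContinuousLinearMap.opNorm_nonneg B
  have hG : 0 ≤ ‖G‖ := norm_nonneg _
  have hK1 : 2 * ‖B‖ + ‖L‖ < 1 := by linarith
  have hK0 : 0 ≤ 2 * ‖B‖ + ‖L‖ := by positivity
  set K : NNReal := ⟨2 * ‖B‖ + ‖L‖, hK0⟩ with hK
  have hKlt : K < 1 := by
    rw [← NNReal.coe_lt_coe]
    exact hK1
  have hlip : LipschitzOnWith K (fun U => B U U + L U + G) (closedBall (0 : X) 1) := by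
    refine LipschitzOnWith.of_dist_le_mul fun U hU V hV => ?_
    rw [mem_closedBall_zero_iff] at hU hV
    rw [dist_eq_norm, dist_eq_norm]
    exact abstractClaim_lipschitz B L G hU hV
  obtain ⟨U, hU, hfix⟩ := Literature.Analysis.Calculus.exists_isFixedPt_mem_closedBall zero_le_one
    hKlt (abstractClaim_mapsTo B L G h) hlip
  rw [mem_closedBall_zero_iff] at hU
  refine ⟨U, ⟨hU, hfix⟩, fun V ⟨hV, hVfix⟩ => ?_⟩
  -- uniqueness: `‖V - U‖ ≤ K‖V - U‖` with `K < 1`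
  have h1 := abstractClaim_lipschitz B L G hV hU
  rw [hVfix, hfix] at h1
  by_contra hne
  have hpos : 0 < ‖V - U‖ := norm_pos_iff.2 (sub_ne_zero.2 hne)
  nlinarith

end AlbrittonBrueColombo2022

end Literature.Analysis.FluidPDE

end
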